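import Summits.QuantumFields.YangMills.Theorems.LuscherReductionTwistedTraceScalingBOAssembly
import Summits.QuantumFields.YangMills.Theorems.LuscherReductionTwistedTraceScalingWindowOneSite
import HarnessLib

/-!
# ★★★ THE `k`-UNIFORM BORN–OPPENHEIMER WINDOW ON THE SOFT TUBE from `BOBricks L χ δ` (brick W3 of the lattice window floor W(L); lane A of S-BASE, crux `TwistedTraceScaling`
# stmt-QuantumFields-20203, line «twolattice», stub `stub_fixedLatticeTraceLaw`; card `pub/ym-fleet/ym-luscher-20007-p1/Lines-window-floor.md`; lead g24)

✓`softTubeBOPackageOn_of_bricks` + ✓`softTubeNoIntruderOn_of_package` prove the per-level soft-tube no-intruder with thresholds depending on `k` (crux ONE at level `k`).  W(L) needs ONE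
threshold for ALL `k`; the bricks (B-N)(B-T)(B-ST)(B-OD) are `k`-free, so the assembly is re-run `k`-UNIFORMLY: `window_quad` (the `2 × 2` Feshbach bound `A x² + 2cxy + D y² ≤ (max A (D+τ) +
c²/τ)(x²+y²)`, no gap needed), `arith_window`, `slow_clause_window` (✓`slow_clause_of_bricks` re-parametrised: one-site input `q(G_a) ≤ X‖G_a‖²`, arithmetic `(1+κ)X + κμ₀ ≤ (1−κ)Y`), and
★★★ `softTubeWindow_of_bricks`: for every `ε > 0`, eventually in `β`, for ALL `k` and every admissible `(k+1)`-family `f` on `supp χ ∩ {orbitDist < δ}` some `a ≠ 0` has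
`T(f_a)·μ₀ ≤ (max μ_k ((1 − θ₀/2)μ₀) + ελ_bμ₀)·λ₀·‖f_a‖²_w` (`θ₀ = K.θ₀`; slow input ✓`innerWindow_one` at `B = L³β`; floor ✓`floor_clause_of_bricks`).
HONEST FRAMING: `k`-uniform twin of a landed assembly; W(L), S-BASE, the crux stay OPEN; CONDITIONAL route R2b1; fixed lattice size; not infinite volume, not a mass gap, not Clay.  No `sorry`.
-/

set_option autoImplicit false

noncomputable section

open MeasureTheory Filter Topology Real
open scoped BigOperators
open Literature.MathematicalPhysics.QuantumFieldTheory
open Literature.MathematicalPhysics.QuantumLattice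

namespace Summit.QuantumFields.YangMills.Theorems.FemtoTransferGap.TwoLattice.ConstTube

open Summit.QuantumFields.YangMills.Theorems.FemtoTransferGap
open Summit.QuantumFields.YangMills.Theorems.FemtoTransferGap.TwoLattice.Avg
open Summit.QuantumFields.YangMills.Theorems.FemtoTransferGap.TwoLattice.Stiff (LinkSpace)

variable {L : ℕ} [NeZero L]

/-! ## §1 Arithmetic -/

/-- ★ **The `2 × 2` Feshbach bound without a gap**: `T_u ≤ S·A·N_u`, `T_v ≤ S·D·N_v`, `X ≤ T_u + 2(cS)√N_u√N_v + T_v` give `X ≤ S·(max A (D+τ) + c²/τ)·(N_u + N_v)` for every `τ > 0`.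
[folklore] -/
theorem window_quad {S A D c τ Nu Nv Tu Tv X : ℝ} (hS : 0 ≤ S) (hτ : 0 < τ) (hNu : 0 ≤ Nu) (hNv : 0 ≤ Nv)
    (hTu : Tu ≤ S * A * Nu) (hTv : Tv ≤ S * D * Nv) (hX : X ≤ Tu + 2 * (c * S) * Real.sqrt Nu * Real.sqrt Nv + Tv) :
    X ≤ S * (max A (D + τ) + c ^ 2 / τ) * (Nu + Nv) := by
  have ha : Real.sqrt Nu ^ 2 = Nu := Real.sq_sqrt hNu
  have hb : Real.sqrt Nv ^ 2 = Nv := Real.sq_sqrt hNv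
  have hcross : 2 * c * Real.sqrt Nu * Real.sqrt Nv ≤ c ^ 2 / τ * Nu + τ * Nv := by
    have h1 : 2 * c * Real.sqrt Nu * Real.sqrt Nv * τ ≤ c ^ 2 * Nu + τ ^ 2 * Nv := by nlinarith [sq_nonneg (c * Real.sqrt Nu - τ * Real.sqrt Nv), ha, hb]
    rw [div_mul_eq_mul_div, ← sub_nonneg]
    have e : c ^ 2 * Nu / τ + τ * Nv - 2 * c * Real.sqrt Nu * Real.sqrt Nv = (c ^ 2 * Nu + τ ^ 2 * Nv - 2 * c * Real.sqrt Nu * Real.sqrt Nv * τ) / τ := by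
      field_simp
    rw [e]; exact div_nonneg (by linarith) hτ.le
  have hAM : A ≤ max A (D + τ) := le_max_left _ _
  have hDM : D + τ ≤ max A (D + τ) := le_max_right _ _
  have h1 : X ≤ S * (A * Nu + (c ^ 2 / τ * Nu + τ * Nv) + D * Nv) := by
    have := mul_le_mul_of_nonneg_left hcross hS
    nlinarith [this, hTu, hTv, hX]
  have h2 : A * Nu + (c ^ 2 / τ * Nu + τ * Nv) + D * Nv ≤ (max A (D + τ) + c ^ 2 / τ) * (Nu + Nv) := by
    have hc2 : 0 ≤ c ^ 2 / τ := div_nonneg (sq_nonneg c) hτ.le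
    nlinarith [mul_le_mul_of_nonneg_right hAM hNu, mul_le_mul_of_nonneg_right hDM hNv, mul_nonneg hc2 hNv]
  calc X ≤ S * (A * Nu + (c ^ 2 / τ * Nu + τ * Nv) + D * Nv) := h1
    _ ≤ S * ((max A (D + τ) + c ^ 2 / τ) * (Nu + Nv)) := mul_le_mul_of_nonneg_left h2 hS
    _ = S * (max A (D + τ) + c ^ 2 / τ) * (Nu + Nv) := by ring

/-- ★ **Window endgame arithmetic**: `0 ≤ y ≤ 1`, `0 ≤ M ≤ μ₀`, `0 ≤ s ≤ 5y/16` ⇒ `e^{y/4}(M + sμ₀) ≤ M + yμ₀`. [folklore] -/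
theorem arith_window {y μ0 M s : ℝ} (hy0 : 0 ≤ y) (hy1 : y ≤ 1) (hμ0 : 0 ≤ μ0) (hM0 : 0 ≤ M) (hM : M ≤ μ0) (hs0 : 0 ≤ s) (hs : s ≤ 5 / 16 * y) :
    Real.exp (y / 4) * (M + s * μ0) ≤ M + y * μ0 := by
  have hexp : Real.exp (y / 4) ≤ 1 + 5 / 16 * y := by
    have h := Real.abs_exp_sub_one_sub_id_le (x := y / 4) (by rw [abs_of_nonneg (by positivity)]; linarith)
    rw [abs_le] at h
    have : (y / 4) ^ 2 ≤ y / 16 := by nlinarith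
    linarith [h.2]
  have h1 : Real.exp (y / 4) * (M + s * μ0) ≤ (1 + 5 / 16 * y) * (M + s * μ0) := mul_le_mul_of_nonneg_right hexp (by positivity)
  have h2 : s * μ0 ≤ 5 / 16 * y * μ0 := mul_le_mul_of_nonneg_right hs hμ0
  have h3 : 5 / 16 * y * M ≤ 5 / 16 * y * μ0 := mul_le_mul_of_nonneg_left hM (by positivity)
  have h4 : 5 / 16 * y * (s * μ0) ≤ 5 / 16 * y * (5 / 16 * y * μ0) := mul_le_mul_of_nonneg_left h2 (by positivity)
  have h5 : 5 / 16 * y * (5 / 16 * y * μ0) ≤ 25 / 256 * y * μ0 := by nlinarith [mul_nonneg hy0 hμ0]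
  nlinarith [h1, h2, h3, h4, h5, mul_nonneg hy0 hμ0]

/-! ## §2 The SLOW clause in window form -/

set_option maxHeartbeats 400000 in
/-- ★★ **SLOW CLAUSE, window form** (fixed `β`): as ✓`slow_clause_of_bricks`, but with the one-site input `q(G_a) ≤ X·‖G_a‖²` for some `a ≠ 0` (any `X > 0`) and the arithmetic
`(1+κ)X + κμ₀ ≤ (1−κ)Y` (any `Y > 0`); conclusion `T(Σ aᵢ P fᵢ) ≤ σ·Y·‖Σ aᵢ P fᵢ‖²_w`.  Proof = ✓`slow_clause_of_bricks` at `e^{ε'λ}μ_k := X`, `e^{ελ/4}μ_k := Y` (`μ_k(L³β) > 0`).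
[cite: Luscher1983, §3] [cite: SjostrandZworski2007, §2] -/
theorem slow_clause_window {β : ℝ} {w : GaugeConfig 3 L SU2 → ℝ} (hw : Measurable w) {Cw : ℝ} (hCw : ∀ U, |w U| ≤ Cw) (hw0 : ∀ U, 0 ≤ w U)
    (hwinv : ∀ (c : SU2) (U : GaugeConfig 3 L SU2), w (gaugeTransform (fun _ : Site 3 L => c) U) = w U)
    {Ω : LinkSpace L → ℝ} (hΩ : Measurable Ω) {CΩ : ℝ} (hCΩ : ∀ x, |Ω x| ≤ CΩ) (hΩinv : ∀ (g : SU2) (v : LinkSpace L), Ω (adL L g v) = Ω v)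
    {𝒰 : Set (GaugeConfig 3 1 SU2)} (h𝒰 : MeasurableSet 𝒰) (h𝒰inv : ∀ (c : SU2) (u : GaugeConfig 3 1 SU2), gaugeTransform (fun _ : Site 3 1 => c) u ∈ 𝒰 ↔ u ∈ 𝒰)
    {δ₁ : ℝ} (h𝒰δ : ∀ u ∈ 𝒰, orbitDist u < δ₁)
    {σ γ κ : ℝ} (hσ : 0 ≤ σ) (hγ : 0 < γ) (hκ0 : 0 ≤ κ) (hκ1 : κ < 1)
    (hN : ∀ u ∈ 𝒰, |fibreMass L w Ω u - γ| ≤ κ * γ)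
    (hT : ∀ φ : GaugeConfig 3 1 SU2 → ℝ, Measurable φ → (∃ C : ℝ, ∀ u, |φ u| ≤ C) → (∀ (g : Site 3 1 → SU2) (u : GaugeConfig 3 1 SU2), φ (gaugeTransform g u) = φ u) →
      (∀ u, φ u ≠ 0 → u ∈ 𝒰) →
      tubeForm β (boFun L φ Ω) ≤ σ * γ * (1 + κ) * qform su2Rep ((L : ℝ) ^ 3 * β) φ φ + κ * σ * γ * levelValue su2Rep 1 ((L : ℝ) ^ 3 * β) 0 * l2 φ φ)
    (hB : 0 < (L : ℝ) ^ 3 * β) {k : ℕ} {X Y : ℝ} (hX : 0 < X) (hY : 0 < Y)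
    (hOS : ∀ G : Fin (k + 1) → (GaugeConfig 3 1 SU2 → ℝ), (∀ i, Measurable (G i)) → (∀ i, ∃ C : ℝ, ∀ U, |G i U| ≤ C) →
      (∀ i (g : Site 3 1 → SU2) (U : GaugeConfig 3 1 SU2), G i (gaugeTransform g U) = G i U) → (∀ i U, G i U ≠ 0 → orbitDist U < δ₁) →
      (∀ a : Fin (k + 1) → ℝ, a ≠ 0 → 0 < l2 (fun U => ∑ i, a i * G i U) (fun U => ∑ i, a i * G i U)) →
        ∃ a : Fin (k + 1) → ℝ, a ≠ 0 ∧
          qform su2Rep ((L : ℝ) ^ 3 * β) (fun U => ∑ i, a i * G i U) (fun U => ∑ i, a i * G i U) ≤ X * l2 (fun U => ∑ i, a i * G i U) (fun U => ∑ i, a i * G i U))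
    (harith : (1 + κ) * X + κ * levelValue su2Rep 1 ((L : ℝ) ^ 3 * β) 0 ≤ (1 - κ) * Y)
    {f : Fin (k + 1) → GaugeConfig 3 L SU2 → ℝ} (hfm : ∀ i, Measurable (f i)) (hfb : ∀ i, ∃ C : ℝ, ∀ U, |f i U| ≤ C) :
    ∃ a : Fin (k + 1) → ℝ, a ≠ 0 ∧
      tubeForm β (fun U => ∑ i, a i * boProj L w Ω 𝒰 (f i) U) ≤ σ * Y * tubeNormSq w (fun U => ∑ i, a i * boProj L w Ω 𝒰 (f i) U) := by
  have hμk : 0 < levelValue su2Rep 1 ((L : ℝ) ^ 3 * β) k := levelValue_su2Rep_pos (L := 1) hB k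
  have hμ0 : 0 < levelValue su2Rep 1 ((L : ℝ) ^ 3 * β) 0 := levelValue_su2Rep_pos (L := 1) hB 0
  have hlam : 0 < bareLambda ((L : ℝ) ^ 3 * β) := bareLambda_pos' hB
  set ε' : ℝ := Real.log (X / levelValue su2Rep 1 ((L : ℝ) ^ 3 * β) k) / bareLambda ((L : ℝ) ^ 3 * β) with hε'
  set ε₂ : ℝ := 4 * (Real.log (Y / levelValue su2Rep 1 ((L : ℝ) ^ 3 * β) k) / bareLambda ((L : ℝ) ^ 3 * β)) with hε₂
  have hX' : Real.exp (ε' * bareLambda ((L : ℝ) ^ 3 * β)) * levelValue su2Rep 1 ((L : ℝ) ^ 3 * β) k = X := by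
    rw [hε', div_mul_cancel₀ _ hlam.ne', Real.exp_log (div_pos hX hμk), div_mul_cancel₀ _ hμk.ne']
  have hY' : Real.exp (ε₂ / 4 * bareLambda ((L : ℝ) ^ 3 * β)) * levelValue su2Rep 1 ((L : ℝ) ^ 3 * β) k = Y := by
    have e : ε₂ / 4 * bareLambda ((L : ℝ) ^ 3 * β) = Real.log (Y / levelValue su2Rep 1 ((L : ℝ) ^ 3 * β) k) := by
      rw [hε₂]; field_simp
    rw [e, Real.exp_log (div_pos hY hμk), div_mul_cancel₀ _ hμk.ne']
  have hOS' : ∀ G : Fin (k + 1) → (GaugeConfig 3 1 SU2 → ℝ), (∀ i, Measurable (G i)) → (∀ i, ∃ C : ℝ, ∀ U, |G i U| ≤ C) →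
      (∀ i (g : Site 3 1 → SU2) (U : GaugeConfig 3 1 SU2), G i (gaugeTransform g U) = G i U) → (∀ i U, G i U ≠ 0 → orbitDist U < δ₁) →
      (∀ a : Fin (k + 1) → ℝ, a ≠ 0 → 0 < l2 (fun U => ∑ i, a i * G i U) (fun U => ∑ i, a i * G i U)) →
        ∃ a : Fin (k + 1) → ℝ, a ≠ 0 ∧
          qform su2Rep ((L : ℝ) ^ 3 * β) (fun U => ∑ i, a i * G i U) (fun U => ∑ i, a i * G i U) * levelValue su2Rep 1 ((L : ℝ) ^ 3 * β) 0 ≤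
            Real.exp (ε' * bareLambda ((L : ℝ) ^ 3 * β)) * levelValue su2Rep 1 ((L : ℝ) ^ 3 * β) k * levelValue su2Rep 1 ((L : ℝ) ^ 3 * β) 0 *
              l2 (fun U => ∑ i, a i * G i U) (fun U => ∑ i, a i * G i U) := by
    intro G h1 h2 h3 h4 h5
    obtain ⟨a, ha, h⟩ := hOS G h1 h2 h3 h4 h5
    refine ⟨a, ha, ?_⟩
    rw [hX']; have := mul_le_mul_of_nonneg_right h hμ0.le; linarith
  have harith' : (1 + κ) * Real.exp (ε' * bareLambda ((L : ℝ) ^ 3 * β)) * levelValue su2Rep 1 ((L : ℝ) ^ 3 * β) k + κ * levelValue su2Rep 1 ((L : ℝ) ^ 3 * β) 0 ≤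
      (1 - κ) * Real.exp (ε₂ / 4 * bareLambda ((L : ℝ) ^ 3 * β)) * levelValue su2Rep 1 ((L : ℝ) ^ 3 * β) k := by
    rw [mul_assoc (1 + κ), hX', mul_assoc (1 - κ), hY']
    exact harith
  obtain ⟨a, ha, h⟩ := slow_clause_of_bricks hw hCw hw0 hwinv hΩ hCΩ hΩinv h𝒰 h𝒰inv h𝒰δ hσ hγ hκ0 hκ1 hN hT hOS' hμ0 hμk.le harith' hfm hfb
  refine ⟨a, ha, ?_⟩
  have e : Real.exp (ε₂ / 4 * bareLambda ((L : ℝ) ^ 3 * β)) * (σ * levelValue su2Rep 1 ((L : ℝ) ^ 3 * β) k) = σ * Y := by rw [← hY']; ring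
  rwa [e] at h

/-! ## §3 ★★★ The `k`-uniform window on the soft tube -/

set_option maxHeartbeats 800000 in
/-- ★★★ **THE `k`-UNIFORM BORN–OPPENHEIMER WINDOW FROM THE BRICKS.**  From `K : BOBricks L χ δ`: for every `ε > 0`, eventually in `β` (ONE threshold for ALL levels), for every `k` and every
family `f₀ … f_k` of bounded measurable functions supported in `supp (χ β) ∩ {orbitDist < δ β}` with nondegenerate weighted Gram matrix there is `a ≠ 0` with
`T(f_a)·μ₀ ≤ (max μ_k ((1 − θ₀/2)·μ₀) + ε·λ_b(L³β)·μ₀)·λ₀(β,L)·‖f_a‖²_w` (`θ₀ = K.θ₀`, `μ_j = levelValue su2Rep 1 (L³β) j`, `w = N/χ`).  Split `f = Pf + (f − Pf)` (✓`boProj`), SLOW by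
`slow_clause_window` with ✓`innerWindow_one`, STIFF/OFF-DIAG = bricks, `window_quad` at `τ = θ₀μ₀/2`, FLOOR ✓`floor_clause_of_bricks`, `arith_window`.
[cite: Luscher1983, §3] [cite: SjostrandZworski2007, §2] -/
theorem softTubeWindow_of_bricks {χ : ℝ → GaugeConfig 3 L SU2 → ℝ} {δ : ℝ → ℝ} (K : BOBricks L χ δ) :
    ∀ ε : ℝ, 0 < ε → ∃ β0 : ℝ, ∀ β : ℝ, β0 ≤ β → ∀ k : ℕ,
      ∀ f : Fin (k + 1) → (GaugeConfig 3 L SU2 → ℝ),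
        (∀ i, Measurable (f i)) → (∀ i, ∃ C : ℝ, ∀ U, |f i U| ≤ C) → (∀ i U, f i U ≠ 0 → χ β U ≠ 0) → (∀ i U, f i U ≠ 0 → orbitDist U < δ β) →
        (∀ a : Fin (k + 1) → ℝ, a ≠ 0 → 0 < tubeNormSq (softWeight (χ β)) (fun U => ∑ i, a i * f i U)) →
          ∃ a : Fin (k + 1) → ℝ, a ≠ 0 ∧
            tubeForm β (fun U => ∑ i, a i * f i U) * levelValue su2Rep 1 ((L : ℝ) ^ 3 * β) 0 ≤
              (max (levelValue su2Rep 1 ((L : ℝ) ^ 3 * β) k) ((1 - K.θ₀ / 2) * levelValue su2Rep 1 ((L : ℝ) ^ 3 * β) 0) +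
                  ε * bareLambda ((L : ℝ) ^ 3 * β) * levelValue su2Rep 1 ((L : ℝ) ^ 3 * β) 0) * levelValue su2Rep L β 0 *
                tubeNormSq (softWeight (χ β)) (fun U => ∑ i, a i * f i U) := by
  intro ε hε
  -- WLOG `ε ≤ 1`
  set ε₁ : ℝ := min ε 1 with hε₁def
  have hε₁ : 0 < ε₁ := lt_min hε one_pos
  have hε₁1 : ε₁ ≤ 1 := min_le_right _ _
  have hε₁ε : ε₁ ≤ ε := min_le_left _ _
  obtain ⟨hθ0, hθ1⟩ := K.hθ₀
  have hL1 : (1 : ℝ) ≤ (L : ℝ) ^ 3 := one_le_pow₀ (by exact_mod_cast NeZero.one_le)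
  have hL3 : (0 : ℝ) < (L : ℝ) ^ 3 := by positivity
  -- the one-site window at radius `δ₁'(B) = δ₁(B/L³)`
  obtain ⟨b1, hb1⟩ := Filter.eventually_atTop.mp K.hδ₁
  have hδ₁' : ∃ β1 : ℝ, ∀ B : ℝ, β1 ≤ B → (fun B => K.δ₁ (B / (L : ℝ) ^ 3)) B ≤ 1 / 2 :=
    ⟨b1 * (L : ℝ) ^ 3, fun B hB => hb1 _ (by show b1 ≤ B / (L : ℝ) ^ 3; rw [le_div_iff₀ hL3]; exact hB)⟩
  obtain ⟨βOS, hOS⟩ := innerWindow_one hδ₁' (ε₁ / 16) (by positivity)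
  -- the localized near-maximiser and the eight copies (FLOOR)
  obtain ⟨βNT, hNT⟩ := exists_localized_near_top (ε₁ / 16) (by positivity)
  obtain ⟨βc, hcross⟩ := crossBound_eventually_small (L := L) (m := K.m) K.hm0 (ε := ε₁ / 16) (by positivity)
  have hτ0 : (0 : ℝ) < 1 := one_pos
  have hev : ∀ᶠ β : ℝ in atTop, ∀ k : ℕ, ∀ f : Fin (k + 1) → (GaugeConfig 3 L SU2 → ℝ),
      (∀ i, Measurable (f i)) → (∀ i, ∃ C : ℝ, ∀ U, |f i U| ≤ C) → (∀ i U, f i U ≠ 0 → χ β U ≠ 0) → (∀ i U, f i U ≠ 0 → orbitDist U < δ β) →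
      (∀ a : Fin (k + 1) → ℝ, a ≠ 0 → 0 < tubeNormSq (softWeight (χ β)) (fun U => ∑ i, a i * f i U)) →
        ∃ a : Fin (k + 1) → ℝ, a ≠ 0 ∧
          tubeForm β (fun U => ∑ i, a i * f i U) * levelValue su2Rep 1 ((L : ℝ) ^ 3 * β) 0 ≤
            (max (levelValue su2Rep 1 ((L : ℝ) ^ 3 * β) k) ((1 - K.θ₀ / 2) * levelValue su2Rep 1 ((L : ℝ) ^ 3 * β) 0) +
                ε * bareLambda ((L : ℝ) ^ 3 * β) * levelValue su2Rep 1 ((L : ℝ) ^ 3 * β) 0) * levelValue su2Rep L β 0 *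
              tubeNormSq (softWeight (χ β)) (fun U => ∑ i, a i * f i U) := by
    filter_upwards [Filter.eventually_ge_atTop (max (max 1 βOS) (max βNT (max βc (2 / (1 : ℝ) ^ 3)))),
      K.hκ_small (ε₁ / 48) (by positivity), K.hb_small (ε₁ * K.θ₀ / 16) (by positivity), K.hcore, K.htube, K.hshadow, K.hbo, K.hδ₂, K.hN, K.hT, K.hST, K.hOD]
      with β hβ hκs hbs hcore htube hshadow hbo hδ₂ hN hT hST hOD
    -- numbers
    have hβ1 : 1 ≤ β := ((le_max_left _ _).trans (le_max_left _ _)).trans hβ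
    have hβ0 : 0 < β := by linarith only [hβ1]
    have hβOS : βOS ≤ β := ((le_max_right _ _).trans (le_max_left _ _)).trans hβ
    have hβNT : βNT ≤ β := ((le_max_left _ _).trans (le_max_right _ _)).trans hβ
    have hβc : βc ≤ β := (((le_max_left _ _).trans (le_max_right _ _)).trans (le_max_right _ _)).trans hβ
    have hβτ : 2 / (1 : ℝ) ^ 3 ≤ β := (((le_max_right _ _).trans (le_max_right _ _)).trans (le_max_right _ _)).trans hβ
    set B : ℝ := (L : ℝ) ^ 3 * β with hBdef
    have hBβ : β ≤ B := by rw [hBdef]; nlinarith only [hL1, hβ0]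
    have hB0 : 0 < B := lt_of_lt_of_le hβ0 hBβ
    set lam : ℝ := bareLambda B with hlamdef
    have hlam0 : 0 < lam := bareLambda_pos' hB0
    have hlam1 : lam ≤ 1 := bareLambda_cube_le (L := L) hτ0 hβτ
    set μ0 : ℝ := levelValue su2Rep 1 B 0 with hμ0def
    have hμ0 : 0 < μ0 := levelValue_su2Rep_pos (L := 1) hB0 0
    -- `y = ε₁ λ`, `κ ≤ y/48`
    set y : ℝ := ε₁ * lam with hydef
    have hy0 : 0 ≤ y := by positivity
    have hy1 : y ≤ 1 := by rw [hydef]; nlinarith only [hε₁1, hlam1, hlam0, hε₁]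
    have hκ0 := K.hκ β
    have hκy : K.κ β ≤ y / 48 := by rw [hydef]; linarith only [hκs]
    have hκ1 : K.κ β < 1 := by linarith only [hκy, hy1]
    have hκ1' : K.κ β ≤ 1 := hκ1.le
    have hκhalf : K.κ β ≤ 1 / 2 := by linarith only [hκy, hy1]
    set w : GaugeConfig 3 L SU2 → ℝ := softWeight (χ β) with hwdef
    obtain ⟨Cw, hCw⟩ := K.hwb β
    obtain ⟨hc0, hcχ⟩ := K.hc β
    -- fibre mass lower bound (for the projection)
    have hZ₀ : 0 < K.γ β * (1 - K.κ β) := mul_pos (K.hγ β) (by linarith)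
    have hZ : ∀ u ∈ K.𝒰 β, K.γ β * (1 - K.κ β) ≤ fibreMass L w (K.Ω β) u := fun u hu => by
      have := (abs_le.mp (hN u hu)).1; linarith only [this]
    -- FLOOR: `e^{−(ε₁/4)λ} σ μ₀ ≤ λ₀`
    have hfl : Real.exp (-(ε₁ / 4 * lam)) * (K.σ β * μ0) ≤ levelValue su2Rep L β 0 := by
      obtain ⟨φ₀, hφm, ⟨C₀, hC₀⟩, hφg, hφsupp, hφpos, hφtop⟩ := hNT B (hβNT.trans hBβ)
      have hφs : ∀ u, φ₀ u ≠ 0 → u ∈ K.𝒰 β := fun u hu => hcore u (hφsupp u hu)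
      have hTφ := hT φ₀ hφm ⟨C₀, hC₀⟩ hφg hφs
      have hTlow : K.σ β * K.γ β * (1 - K.κ β) * qform su2Rep B φ₀ φ₀ - K.κ β * K.σ β * K.γ β * μ0 * l2 φ₀ φ₀ ≤ tubeForm β (boFun L φ₀ (K.Ω β)) := by
        have := (abs_le.mp hTφ).1; linarith only [this]
      have hcB : 28 * crossBound L β K.m ≤ ε₁ / 16 * lam * levelValue su2Rep L β 0 :=
        (hcross β hβc).trans (mul_le_mul_of_nonneg_left (levelValue_zero_ge_uniform hβ1) (by positivity))
      have harith : Real.exp (-(ε₁ / 4 * lam)) * ((1 + ε₁ / 16 * lam / 4) * (1 + K.κ β)) ≤ (1 - K.κ β) * Real.exp (-(ε₁ / 16 * lam)) - K.κ β := by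
        have h := arith_floor hy0 hy1 hκ0 hκy
        have e1 : ε₁ / 4 * lam = y / 4 := by rw [hydef]; ring
        have e2 : ε₁ / 16 * lam / 4 = y / 64 := by rw [hydef]; ring
        have e3 : ε₁ / 16 * lam = y / 16 := by rw [hydef]; ring
        rw [e1, e2, e3]; exact h
      exact floor_clause_of_bricks hβ0.le (K.hχm β) (K.hχ1 β) (K.hχ0 β) hc0 hcχ (K.hwm β) hCw (K.hΩm β) (K.hΩ1 β) K.hm hδ₂
        (fun φ U hφ hU => hbo φ U hφ hU) (K.hσ β).le (K.hγ β) hκ0 hκ1' hN hφm hC₀ hφs hφpos hφtop hTlow hcB (by positivity) hμ0.le harith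
    -- the families
    intro k f hfm hfb hfs hfS hGram
    set u : Fin (k + 1) → GaugeConfig 3 L SU2 → ℝ := fun i => boProj L w (K.Ω β) (K.𝒰 β) (f i) with hudef
    set v : Fin (k + 1) → GaugeConfig 3 L SU2 → ℝ := fun i => fun U => f i U - u i U with hvdef
    choose Cf hCf using hfb
    have hfam : ∀ a : Fin (k + 1) → ℝ, Measurable (fun U => ∑ i, a i * f i U) := fun a => Finset.measurable_sum _ fun i _ => (hfm i).const_mul _
    have hfab : ∀ a : Fin (k + 1) → ℝ, ∀ U, |∑ i, a i * f i U| ≤ ∑ i, |a i| * Cf i := fun a U =>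
      (Finset.abs_sum_le_sum_abs _ _).trans (Finset.sum_le_sum fun i _ => by rw [abs_mul]; exact mul_le_mul_of_nonneg_left (hCf i U) (abs_nonneg _))
    have hfas : ∀ (a : Fin (k + 1) → ℝ) U, (∑ i, a i * f i U) ≠ 0 → χ β U ≠ 0 := fun a U hU => by
      obtain ⟨i, hi⟩ := exists_ne_zero_of_combination_ne_zero hU; exact hfs i U hi
    have hfash : ∀ (a : Fin (k + 1) → ℝ) U, (∑ i, a i * f i U) ≠ 0 → slowMean L U ∈ K.𝒰 β := fun a U hU => by
      obtain ⟨i, hi⟩ := exists_ne_zero_of_combination_ne_zero hU; exact hshadow U (hfs i U hi) (hfS i U hi)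
    have hua : ∀ a : Fin (k + 1) → ℝ, (fun U => ∑ i, a i * u i U) = boProj L w (K.Ω β) (K.𝒰 β) (fun U => ∑ i, a i * f i U) := fun a => by
      funext U; exact (boProj_sum (K.hwm β) hCw (K.hΩm β) (K.hΩ1 β) (K.𝒰 β) a hfm (fun i => ⟨Cf i, hCf i⟩) U).symm
    have hva : ∀ a : Fin (k + 1) → ℝ, (fun U => ∑ i, a i * v i U) = fun U => (∑ i, a i * f i U) - boProj L w (K.Ω β) (K.𝒰 β) (fun U => ∑ i, a i * f i U) U := fun a => by
      funext U
      rw [← congrFun (hua a) U]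
      simp only [hvdef, mul_sub, Finset.sum_sub_distrib]
    have hPm : ∀ a : Fin (k + 1) → ℝ, Measurable (boProj L w (K.Ω β) (K.𝒰 β) (fun U => ∑ i, a i * f i U)) := fun a =>
      measurable_boFun L (measurable_boCoeff (K.hwm β) (K.hΩm β) (K.h𝒰m β) (hfam a)) (K.hΩm β)
    have hPb : ∀ a : Fin (k + 1) → ℝ, ∀ U, |boProj L w (K.Ω β) (K.𝒰 β) (fun U => ∑ i, a i * f i U) U| ≤
        (∑ i, |a i| * Cf i) * 1 * Cw * (orthoTransverse L).real Set.univ / (K.γ β * (1 - K.κ β)) * 1 := fun a =>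
      abs_boFun_le L (abs_boCoeff_le hCw (K.hΩ1 β) hZ₀ hZ (hfab a)) (K.hΩ1 β)
    have hrem := fun a : Fin (k + 1) → ℝ => remainder_props (K.hwm β) hCw (K.hΩm β) (K.hΩ1 β) (K.h𝒰m β) hZ₀ hZ (fun φ U hφ hU => (hbo φ U hφ hU).1)
      (hfam a) (hfab a) (hfas a) (hfash a)
    have hvm : ∀ a : Fin (k + 1) → ℝ, Measurable (fun U => (∑ i, a i * f i U) - boProj L w (K.Ω β) (K.𝒰 β) (fun U => ∑ i, a i * f i U) U) := fun a =>
      (hfam a).sub (hPm a)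
    have hvb : ∀ a : Fin (k + 1) → ℝ, ∀ U, |(∑ i, a i * f i U) - boProj L w (K.Ω β) (K.𝒰 β) (fun U => ∑ i, a i * f i U) U| ≤
        (∑ i, |a i| * Cf i) + (∑ i, |a i| * Cf i) * 1 * Cw * (orthoTransverse L).real Set.univ / (K.γ β * (1 - K.κ β)) * 1 := fun a U =>
      (abs_sub _ _).trans (add_le_add (hfab a U) (hPb a U))
    -- SLOW (window form): `X = μ_k + (ε₁/16)λμ₀`, `Y = ((1+κ)X + κμ₀)/(1−κ)`
    set μk : ℝ := levelValue su2Rep 1 B k with hμkdef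
    have hμk0 : 0 ≤ μk := (levelValue_su2Rep_pos (L := 1) hB0 k).le
    have hμkμ0 : μk ≤ μ0 := levelValue_le_of_le (L := 1) hB0 (Nat.zero_le k)
    set X : ℝ := μk + ε₁ / 16 * lam * μ0 with hXdef
    have hX0 : 0 < X := by rw [hXdef]; positivity
    set Y : ℝ := ((1 + K.κ β) * X + K.κ β * μ0) / (1 - K.κ β) with hYdef
    have h1κ : 0 < 1 - K.κ β := by linarith only [hκ1]
    have hY0 : 0 < Y := by rw [hYdef]; positivity
    have harithY : (1 + K.κ β) * X + K.κ β * μ0 ≤ (1 - K.κ β) * Y := by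
      rw [hYdef, mul_div_cancel₀ _ h1κ.ne']
    have hYle : Y ≤ μk + (6 * K.κ β + ε₁ / 16 * lam) * μ0 := by
      rw [hYdef, div_le_iff₀ h1κ, hXdef]
      have hκ48 : K.κ β ≤ 1 / 48 := by linarith only [hκy, hy1]
      have he : ε₁ / 16 * lam ≤ 1 / 16 := by nlinarith only [hε₁1, hlam1, hlam0, hε₁]
      have h1 : K.κ β * μk ≤ K.κ β * μ0 := mul_le_mul_of_nonneg_left hμkμ0 hκ0
      have h2 : K.κ β * K.κ β * μ0 ≤ 1 / 48 * K.κ β * μ0 := by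
        have := mul_le_mul_of_nonneg_left hκ48 (mul_nonneg hκ0 hμ0.le)
        nlinarith only [this]
      have h3 : ε₁ / 16 * lam * K.κ β * μ0 ≤ 1 / 16 * K.κ β * μ0 := by
        have := mul_le_mul_of_nonneg_left he (mul_nonneg hκ0 hμ0.le)
        nlinarith only [this]
      have h4 : 0 ≤ K.κ β * μ0 := mul_nonneg hκ0 hμ0.le
      nlinarith only [h1, h2, h3, h4]
    have hTup : ∀ φ : GaugeConfig 3 1 SU2 → ℝ, Measurable φ → (∃ C : ℝ, ∀ u, |φ u| ≤ C) →
        (∀ (g : Site 3 1 → SU2) (u : GaugeConfig 3 1 SU2), φ (gaugeTransform g u) = φ u) → (∀ u, φ u ≠ 0 → u ∈ K.𝒰 β) →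
        tubeForm β (boFun L φ (K.Ω β)) ≤ K.σ β * K.γ β * (1 + K.κ β) * qform su2Rep ((L : ℝ) ^ 3 * β) φ φ + K.κ β * K.σ β * K.γ β * levelValue su2Rep 1 ((L : ℝ) ^ 3 * β) 0 * l2 φ φ :=
      fun φ h1 h2 h3 h4 => by have := (abs_le.mp (hT φ h1 h2 h3 h4)).2; linarith only [this]
    have hOSB : ∀ G : Fin (k + 1) → (GaugeConfig 3 1 SU2 → ℝ), (∀ i, Measurable (G i)) → (∀ i, ∃ C : ℝ, ∀ U, |G i U| ≤ C) →
        (∀ i (g : Site 3 1 → SU2) (U : GaugeConfig 3 1 SU2), G i (gaugeTransform g U) = G i U) → (∀ i U, G i U ≠ 0 → orbitDist U < K.δ₁ β) →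
        (∀ a : Fin (k + 1) → ℝ, a ≠ 0 → 0 < l2 (fun U => ∑ i, a i * G i U) (fun U => ∑ i, a i * G i U)) →
          ∃ a : Fin (k + 1) → ℝ, a ≠ 0 ∧
            qform su2Rep ((L : ℝ) ^ 3 * β) (fun U => ∑ i, a i * G i U) (fun U => ∑ i, a i * G i U) ≤ X * l2 (fun U => ∑ i, a i * G i U) (fun U => ∑ i, a i * G i U) := by
      intro G h1 h2 h3 h4 h5
      have hδ₁B : K.δ₁ (B / (L : ℝ) ^ 3) = K.δ₁ β := by rw [hBdef, mul_comm, mul_div_assoc, div_self hL3.ne', mul_one]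
      have h := hOS B (hβOS.trans hBβ) k G h1 h2 h3 (fun i U hU => by show orbitDist U < K.δ₁ (B / (L : ℝ) ^ 3); rw [hδ₁B]; exact h4 i U hU) h5
      rw [hXdef]
      exact h
    obtain ⟨a, ha, hslow⟩ := slow_clause_window (K.hwm β) hCw (K.hw0 β) (K.hwinv β) (K.hΩm β) (K.hΩ1 β) (K.hΩinv β) (K.h𝒰m β) (K.h𝒰inv β)
      (K.h𝒰δ₁ β) (K.hσ β).le (K.hγ β) hκ0 hκ1 hN hTup hB0 hX0 hY0 hOSB harithY hfm (fun i => ⟨Cf i, hCf i⟩)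
    refine ⟨a, ha, ?_⟩
    -- the clauses for this `a`
    have hNu0 : 0 ≤ tubeNormSq w (fun U => ∑ i, a i * u i U) := integral_nonneg fun U => mul_nonneg (sq_nonneg _) (K.hw0 β U)
    have hNv0 : 0 ≤ tubeNormSq w (fun U => ∑ i, a i * v i U) := integral_nonneg fun U => mul_nonneg (sq_nonneg _) (K.hw0 β U)
    have hNf0 : 0 ≤ tubeNormSq w (fun U => ∑ i, a i * f i U) := integral_nonneg fun U => mul_nonneg (sq_nonneg _) (K.hw0 β U)
    have hmass : tubeNormSq w (fun U => ∑ i, a i * u i U) + tubeNormSq w (fun U => ∑ i, a i * v i U) ≤ tubeNormSq w (fun U => ∑ i, a i * f i U) := by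
      rw [hua a, hva a]
      exact le_of_eq (tubeNormSq_boProj_add (K.hwm β) hCw (K.hΩm β) (K.hΩ1 β) (K.h𝒰m β) hZ₀ hZ (hfam a) (hfab a))
    have hstiff : tubeForm β (fun U => ∑ i, a i * v i U) ≤ (1 - K.θ₀) * (K.σ β * μ0) * tubeNormSq w (fun U => ∑ i, a i * v i U) := by
      rw [hva a]
      exact hST _ (hvm a) ⟨_, hvb a⟩ (hrem a).1 (hrem a).2
    have hum' : Measurable (fun U => ∑ i, a i * u i U) := by rw [hua a]; exact hPm a
    have hub' : ∀ U, |∑ i, a i * u i U| ≤ (∑ i, |a i| * Cf i) * 1 * Cw * (orthoTransverse L).real Set.univ / (K.γ β * (1 - K.κ β)) * 1 := fun U => by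
      have e := congrFun (hua a) U; rw [e]; exact hPb a U
    have hvm' : Measurable (fun U => ∑ i, a i * v i U) := by rw [hva a]; exact hvm a
    have hvb' : ∀ U, |∑ i, a i * v i U| ≤ (∑ i, |a i| * Cf i) + (∑ i, |a i| * Cf i) * 1 * Cw * (orthoTransverse L).real Set.univ / (K.γ β * (1 - K.κ β)) * 1 :=
      fun U => by have e := congrFun (hva a) U; rw [e]; exact hvb a U
    have hvs' : ∀ U, (∑ i, a i * v i U) ≠ 0 → χ β U ≠ 0 := fun U hU => by
      have e := congrFun (hva a) U; rw [e] at hU; exact (hrem a).1 U hU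
    have hvo' : ∀ u', fibreInner L w (K.Ω β) (fun U => ∑ i, a i * v i U) u' = 0 := fun u' => by rw [hva a]; exact (hrem a).2 u'
    have hoff : tubeForm β (fun U => ∑ i, a i * f i U) ≤ tubeForm β (fun U => ∑ i, a i * u i U) +
        2 * (K.b β * μ0 * K.σ β) * Real.sqrt (tubeNormSq w (fun U => ∑ i, a i * u i U)) * Real.sqrt (tubeNormSq w (fun U => ∑ i, a i * v i U)) +
        tubeForm β (fun U => ∑ i, a i * v i U) := by
      have hsplit : (fun U => ∑ i, a i * f i U) = fun U => (∑ i, a i * u i U) + (∑ i, a i * v i U) := by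
        funext U; rw [← Finset.sum_add_distrib]; exact Finset.sum_congr rfl fun i _ => by simp only [hvdef]; ring
      rw [hsplit, tubeForm_add β hum' hub' hvm' hvb']
      have hcs : ∀ u', boCoeff L w (K.Ω β) (K.𝒰 β) (fun U => ∑ i, a i * f i U) u' ≠ 0 → u' ∈ K.𝒰 β := fun u' hu => by
        by_contra hnu; exact hu (show boCoeff L w (K.Ω β) (K.𝒰 β) _ u' = 0 by unfold boCoeff; rw [Set.indicator_of_notMem hnu])
      have e1 : boFun L (boCoeff L w (K.Ω β) (K.𝒰 β) (fun U => ∑ i, a i * f i U)) (K.Ω β) = fun U => ∑ i, a i * u i U := (hua a).symm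
      obtain ⟨h1, h2⟩ := hOD (boCoeff L w (K.Ω β) (K.𝒰 β) (fun U => ∑ i, a i * f i U)) (fun U => ∑ i, a i * v i U)
        (measurable_boCoeff (K.hwm β) (K.hΩm β) (K.h𝒰m β) (hfam a)) ⟨_, abs_boCoeff_le hCw (K.hΩ1 β) hZ₀ hZ (hfab a)⟩ hcs hvm' ⟨_, hvb'⟩ hvs' hvo'
      rw [e1] at h1 h2
      have h1' := (abs_le.mp h1).2
      have h2' := (abs_le.mp h2).2
      nlinarith only [h1', h2']
    -- the 2×2 bound at `τ = θ₀μ₀/2`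
    have hτ : 0 < K.θ₀ * μ0 / 2 := by positivity
    have hTu : tubeForm β (fun U => ∑ i, a i * u i U) ≤ K.σ β * Y * tubeNormSq w (fun U => ∑ i, a i * u i U) := hslow
    have hTv : tubeForm β (fun U => ∑ i, a i * v i U) ≤ K.σ β * ((1 - K.θ₀) * μ0) * tubeNormSq w (fun U => ∑ i, a i * v i U) := by
      have e : (1 - K.θ₀) * (K.σ β * μ0) = K.σ β * ((1 - K.θ₀) * μ0) := by ring
      rw [← e]; exact hstiff
    have hquad := window_quad (K.hσ β).le hτ hNu0 hNv0 hTu hTv hoff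
    have eD : (1 - K.θ₀) * μ0 + K.θ₀ * μ0 / 2 = (1 - K.θ₀ / 2) * μ0 := by ring
    have ec : (K.b β * μ0) ^ 2 / (K.θ₀ * μ0 / 2) = 2 * K.b β ^ 2 / K.θ₀ * μ0 := by
      field_simp
    rw [eD, ec] at hquad
    -- the coefficient: `C := max Y ((1−θ₀/2)μ₀) + (2b²/θ₀)μ₀ ≤ M + sμ₀`, `M = max μ_k ((1−θ₀/2)μ₀)`
    set M : ℝ := max μk ((1 - K.θ₀ / 2) * μ0) with hMdef
    have hM0 : 0 ≤ M := le_trans hμk0 (le_max_left _ _)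
    have hMμ0 : M ≤ μ0 := max_le hμkμ0 (by nlinarith only [hθ0, hμ0])
    set s : ℝ := 6 * K.κ β + ε₁ / 16 * lam + 2 * K.b β ^ 2 / K.θ₀ with hsdef
    have hb2 : 2 * K.b β ^ 2 / K.θ₀ ≤ ε₁ / 8 * lam := by
      rw [div_le_iff₀ hθ0]
      have : K.b β ^ 2 ≤ ε₁ * K.θ₀ / 16 * lam := hbs
      nlinarith only [this, hθ0]
    have hs0 : 0 ≤ s := by rw [hsdef]; positivity
    have hs : s ≤ 5 / 16 * y := by rw [hsdef, hydef]; nlinarith only [hκy, hb2, hydef, hlam0, hε₁]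
    have hcoef : max Y ((1 - K.θ₀ / 2) * μ0) + 2 * K.b β ^ 2 / K.θ₀ * μ0 ≤ M + s * μ0 := by
      have h1 : max Y ((1 - K.θ₀ / 2) * μ0) ≤ M + (6 * K.κ β + ε₁ / 16 * lam) * μ0 := by
        refine max_le ?_ ?_
        · exact hYle.trans (by nlinarith only [le_max_left μk ((1 - K.θ₀ / 2) * μ0), hMdef])
        · have : 0 ≤ (6 * K.κ β + ε₁ / 16 * lam) * μ0 := by positivity
          linarith only [le_max_right μk ((1 - K.θ₀ / 2) * μ0), this, hMdef]
      rw [hsdef]; nlinarith only [h1, hμ0]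
    have hC0 : 0 ≤ max Y ((1 - K.θ₀ / 2) * μ0) + 2 * K.b β ^ 2 / K.θ₀ * μ0 := by
      have : 0 ≤ 2 * K.b β ^ 2 / K.θ₀ * μ0 := by positivity
      linarith only [le_max_left Y ((1 - K.θ₀ / 2) * μ0), hY0, this]
    -- `T(f_a) ≤ σ·(M + sμ₀)·N(f_a)`
    have hT1 : tubeForm β (fun U => ∑ i, a i * f i U) ≤ K.σ β * (M + s * μ0) * tubeNormSq w (fun U => ∑ i, a i * f i U) := by
      refine hquad.trans ?_
      have h1 : K.σ β * (max Y ((1 - K.θ₀ / 2) * μ0) + 2 * K.b β ^ 2 / K.θ₀ * μ0) *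
          (tubeNormSq w (fun U => ∑ i, a i * u i U) + tubeNormSq w (fun U => ∑ i, a i * v i U)) ≤
          K.σ β * (max Y ((1 - K.θ₀ / 2) * μ0) + 2 * K.b β ^ 2 / K.θ₀ * μ0) * tubeNormSq w (fun U => ∑ i, a i * f i U) :=
        mul_le_mul_of_nonneg_left hmass (mul_nonneg (K.hσ β).le hC0)
      refine h1.trans ?_
      exact mul_le_mul_of_nonneg_right (mul_le_mul_of_nonneg_left hcoef (K.hσ β).le) hNf0
    -- FLOOR and the endgame: `σμ₀(M + sμ₀) ≤ e^{y/4}λ₀(M + sμ₀)`, `e^{y/4}(M + sμ₀) ≤ M + yμ₀ ≤ M + ελμ₀`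
    have hσμ : K.σ β * μ0 ≤ Real.exp (y / 4) * levelValue su2Rep L β 0 := by
      have e1 : ε₁ / 4 * lam = y / 4 := by rw [hydef]; ring
      rw [e1] at hfl
      have h := mul_le_mul_of_nonneg_left hfl (Real.exp_pos (y / 4)).le
      rw [← mul_assoc, ← Real.exp_add, add_neg_cancel, Real.exp_zero, one_mul] at h
      exact h
    have hΛ0 : 0 ≤ levelValue su2Rep L β 0 := (levelValue_su2Rep_pos hβ0 0).le
    have hend : Real.exp (y / 4) * (M + s * μ0) ≤ M + y * μ0 := arith_window hy0 hy1 hμ0.le hM0 hMμ0 hs0 hs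
    have hyε : y * μ0 ≤ ε * lam * μ0 := by rw [hydef]; exact mul_le_mul_of_nonneg_right (mul_le_mul_of_nonneg_right hε₁ε hlam0.le) hμ0.le
    calc tubeForm β (fun U => ∑ i, a i * f i U) * μ0
        ≤ K.σ β * (M + s * μ0) * tubeNormSq w (fun U => ∑ i, a i * f i U) * μ0 := mul_le_mul_of_nonneg_right hT1 hμ0.le
      _ = (K.σ β * μ0) * (M + s * μ0) * tubeNormSq w (fun U => ∑ i, a i * f i U) := by ring
      _ ≤ (Real.exp (y / 4) * levelValue su2Rep L β 0) * (M + s * μ0) * tubeNormSq w (fun U => ∑ i, a i * f i U) :=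
          mul_le_mul_of_nonneg_right (mul_le_mul_of_nonneg_right hσμ (by positivity)) hNf0
      _ = (Real.exp (y / 4) * (M + s * μ0)) * levelValue su2Rep L β 0 * tubeNormSq w (fun U => ∑ i, a i * f i U) := by ring
      _ ≤ (M + y * μ0) * levelValue su2Rep L β 0 * tubeNormSq w (fun U => ∑ i, a i * f i U) :=
          mul_le_mul_of_nonneg_right (mul_le_mul_of_nonneg_right hend hΛ0) hNf0
      _ ≤ (M + ε * lam * μ0) * levelValue su2Rep L β 0 * tubeNormSq w (fun U => ∑ i, a i * f i U) :=
          mul_le_mul_of_nonneg_right (mul_le_mul_of_nonneg_right (by linarith only [hyε]) hΛ0) hNf0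
  exact Filter.eventually_atTop.mp hev

end Summit.QuantumFields.YangMills.Theorems.FemtoTransferGap.TwoLattice.ConstTube

end
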